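import Literature.NumberTheory.LFunctions.DirichletLogDerivDisc
import Literature.NumberTheory.LFunctions.ZetaLogDerivDisc
import HarnessLib

/-!
# The local partial fraction of `F_{q,a} = −L₁'/L₁(s, χ₀) − ∑_{χ ≠ χ₀} χ̄(a) L'/L(s, χ)` on the
# discs `|s − (2 + it)| ≤ 38/25`, uniformly in `q` (Montgomery–Vaughan Lemma 12.6, right half)

Topic `Literature/NumberTheory/LFunctions`. Everything in this file is PROVED (theorems only).

For a reduced residue `a mod q` the Dirichlet series of `Λ_{q,a}(n) = φ(q)Λ(n)𝟙_{n ≡ a (q)}` is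
`1/(s − 1) + F_{q,a}(s)` with `F_{q,a} = φ(q) ·` (Mathlib's
`ArithmeticFunction.vonMangoldt.LFunctionResidueClassAux a`)
` = −L₁'/L₁(s, χ₀) − ∑_{χ ≠ χ₀} χ̄(a) L'/L(s, χ)`, `L₁(s, χ₀) = (s − 1)L(s, χ₀) = ζ₁(s)∏_{p ∣ q}(1 − p^{-s})`
(MV (11.22), (4.22)). Combining the disc packages of the tree for `ζ₁`
(`Literature.NumberTheory.LFunctions.exists_norm_logDeriv_riemannZeta₁_sub_sum_le`, `ZetaLogDerivDisc.lean`)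
and for `L(s, χ)`, `χ ≠ χ₀` (`Literature.NumberTheory.LFunctions.DirichletDisc.exists_norm_logDeriv_sub_sum_le`,
`DirichletLogDerivDisc.lean`) with the elementary bound `|P'/P(s)| ≪ log q` for the Euler factor
`P(s) = ∏_{p ∣ q}(1 − p^{-s})` on `σ ≥ 1/4`, we obtain the local partial fraction of `F_{q,a}`:

* `Literature.NumberTheory.LFunctions.DirichletSegments.exists_package` — an absolute `C` such
  that for all `q`, `a mod q`, real `t` there are a finite set `Z` of zeros of `∏_χ L(s, χ)` with
  `3/20 ≤ Re ρ < 1`, `|Im ρ − t| ≤ 2`, and complex weights `w` with `∑_{ρ ∈ Z} |w(ρ)| ≤ C φ(q) ℒ`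
  (`ℒ = log q + log(|t| + 4)`), such that on `|s − (2 + it)| ≤ 38/25` (off `s = 1` and the
  zeros) `F_{q,a}(s) = ∑_{ρ ∈ Z} w(ρ)/(s − ρ) + O(φ(q) ℒ)`, and consequently
  `|F_{q,a}(s)| ≤ C φ(q)(1 + 1/d) ℒ` when all `ρ ∈ Z` are at distance `≥ d` from `s`
  (MV Lemma 12.6 summed over the characters; the weights are `−χ̄(a) m_χ(ρ)`).
* `Literature.NumberTheory.LFunctions.DirichletSegments.differentiableAt_Faux` — `F_{q,a}` is
  holomorphic at every `s` with `s = 1` or `L(s, χ) ≠ 0` for all `χ` (Mathlib's continuity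
  statement, sharpened to differentiability).

The disc `|s − (2 + it)| ≤ 38/25` contains `σ + it'` for `1/2 ≤ σ ≤ 2`, `|t' − t| ≤ 1/20`
(`Literature.NumberTheory.LFunctions.DirichletDisc.mem_closedBall_of_re_mem_Icc`): these are the
"segments" of the vertical lines `Re s = σ ≥ 1/2` on which the partial fraction is used.

## References

* H. L. Montgomery, R. C. Vaughan, *Multiplicative Number Theory I. Classical Theory*, CUP 2007,
  (4.22), Lemma 11.1 (proof, the Euler factor), (11.22), Lemma 12.6 (`MontgomeryVaughan2007`).
-/

noncomputable section

open Complex Set Metric Filter Topology Real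
open ArithmeticFunction.vonMangoldt DirichletCharacter

namespace Literature.NumberTheory.LFunctions.DirichletSegments

/-! ### The Euler factor `P(s) = ∏_{p ∣ q}(1 − p^{-s})` on `σ ≥ 1/4` -/

/-- `K₀ = 2^{-1/4}`, the bound for `|p^{-s}|`, `σ ≥ 1/4`. [folklore] -/
def K₀ : ℝ := (2 : ℝ) ^ (-(1 / 4 : ℝ))

/-- `0 < K₀`. [folklore] -/
theorem K₀_pos : 0 < K₀ := Real.rpow_pos_of_pos (by norm_num) _

/-- `K₀ < 1`. [folklore] -/
theorem K₀_lt_one : K₀ < 1 := Real.rpow_lt_one_of_one_lt_of_neg (by norm_num) (by norm_num)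

/-- For a prime `p` and `σ = Re s ≥ 1/4`: `‖p^{-s}‖ ≤ 2^{-1/4} = K₀`. [folklore] -/
theorem norm_prime_cpow_neg_le {p : ℕ} (hp : p.Prime) {s : ℂ} (hs : 1 / 4 ≤ s.re) :
    ‖(p : ℂ) ^ (-s)‖ ≤ K₀ := by
  have hp2 : (2 : ℝ) ≤ p := by exact_mod_cast hp.two_le
  rw [Complex.norm_natCast_cpow_of_pos hp.pos, Complex.neg_re]
  calc (p : ℝ) ^ (-s.re) ≤ (2 : ℝ) ^ (-s.re) :=
        Real.rpow_le_rpow_of_nonpos (by norm_num) hp2 (by linarith)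
    _ ≤ (2 : ℝ) ^ (-(1 / 4) : ℝ) :=
        Real.rpow_le_rpow_of_exponent_le (by norm_num) (by linarith)

/-- The Euler factor `P_q(s) = ∏_{p ∣ q}(1 − p^{-s})` of `L(s, χ₀) = ζ(s)P_q(s)`.
[cite: MontgomeryVaughan2007, Lemma 11.1 (proof, eq. (4.22))] -/
def eulerFactor (q : ℕ) (s : ℂ) : ℂ := ∏ p ∈ q.primeFactors, (1 - (p : ℂ) ^ (-s))

/-- `P_q` is entire. [folklore] -/
theorem differentiable_eulerFactor (q : ℕ) : Differentiable ℂ (eulerFactor q) := by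
  refine Differentiable.fun_finsetProd (𝕜 := ℂ) (f := fun (p : ℕ) (s : ℂ) ↦ 1 - (p : ℂ) ^ (-s))
    fun p hp ↦ ?_
  have hp0 : (p : ℂ) ≠ 0 := Nat.cast_ne_zero.2 (Nat.prime_of_mem_primeFactors hp).ne_zero
  exact (differentiable_const (1 : ℂ)).sub
    ((differentiable_id (𝕜 := ℂ)).neg.const_cpow (c := (p : ℂ)) (Or.inl hp0))

/-- On `σ ≥ 1/4` the Euler factor does not vanish and
`‖P_q'/P_q(s)‖ ≤ (K₀/(1 − K₀)) log q` (`P'/P = ∑_{p ∣ q}(log p)p^{-s}/(1 − p^{-s})`, `|p^{-s}| ≤ K₀`,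
`∑_{p ∣ q} log p ≤ log q`). [cite: MontgomeryVaughan2007, Lemma 11.1 (proof)] -/
theorem eulerFactor_ne_zero_and_norm_logDeriv_le (q : ℕ) [NeZero q] {s : ℂ} (hs : 1 / 4 ≤ s.re) :
    eulerFactor q s ≠ 0 ∧ ‖logDeriv (eulerFactor q) s‖ ≤ K₀ / (1 - K₀) * Real.log q := by
  have hK0 := K₀_pos
  have hK1 := K₀_lt_one
  have hfac : ∀ p ∈ q.primeFactors, (1 - (p : ℂ) ^ (-s)) ≠ 0 := by
    intro p hp h
    have hn := norm_prime_cpow_neg_le (Nat.prime_of_mem_primeFactors hp) hs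
    rw [sub_eq_zero] at h
    rw [← h, norm_one] at hn
    linarith
  refine ⟨Finset.prod_ne_zero_iff.2 hfac, ?_⟩
  have hdiff : ∀ p ∈ q.primeFactors, DifferentiableAt ℂ (fun s : ℂ ↦ 1 - (p : ℂ) ^ (-s)) s := by
    intro p hp
    have hp0 : (p : ℂ) ≠ 0 := Nat.cast_ne_zero.2 (Nat.prime_of_mem_primeFactors hp).ne_zero
    exact ((differentiable_const (1 : ℂ)).sub
      ((differentiable_id (𝕜 := ℂ)).neg.const_cpow (c := (p : ℂ)) (Or.inl hp0))) s
  have hfun : eulerFactor q = fun s ↦ ∏ p ∈ q.primeFactors, (fun (p : ℕ) (s : ℂ) ↦ 1 - (p : ℂ) ^ (-s)) p s :=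
    rfl
  rw [hfun, logDeriv_prod (ι := ℕ) (s := q.primeFactors)
    (f := fun (p : ℕ) (s : ℂ) ↦ 1 - (p : ℂ) ^ (-s)) hfac hdiff]
  -- each term
  have hterm : ∀ p ∈ q.primeFactors,
      ‖logDeriv (fun s : ℂ ↦ 1 - (p : ℂ) ^ (-s)) s‖ ≤ K₀ / (1 - K₀) * Real.log p := by
    intro p hp
    have hprime := Nat.prime_of_mem_primeFactors hp
    have hp0 : (p : ℂ) ≠ 0 := Nat.cast_ne_zero.2 hprime.ne_zero
    have hlogp : 0 ≤ Real.log p := Real.log_natCast_nonneg p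
    have hderiv : deriv (fun s : ℂ ↦ 1 - (p : ℂ) ^ (-s)) s = (p : ℂ) ^ (-s) * Complex.log p := by
      have h1 : HasDerivAt (fun s : ℂ ↦ (p : ℂ) ^ (-s)) ((p : ℂ) ^ (-s) * Complex.log p * (-1)) s :=
        (hasDerivAt_neg s).const_cpow (Or.inl hp0)
      have h2 : HasDerivAt (fun s : ℂ ↦ 1 - (p : ℂ) ^ (-s))
          (0 - (p : ℂ) ^ (-s) * Complex.log p * (-1)) s := (hasDerivAt_const s (1 : ℂ)).sub h1
      rw [h2.deriv]; ring
    have hn := norm_prime_cpow_neg_le hprime hs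
    have hden : 1 - K₀ ≤ ‖1 - (p : ℂ) ^ (-s)‖ := by
      have := norm_sub_norm_le (1 : ℂ) ((p : ℂ) ^ (-s))
      rw [norm_one] at this
      linarith
    have hlogC : ‖Complex.log p‖ = Real.log p := by
      rw [show (p : ℂ) = ((p : ℝ) : ℂ) by push_cast; rfl, ← Complex.ofReal_log (Nat.cast_nonneg p),
        Complex.norm_real, Real.norm_of_nonneg hlogp]
    rw [logDeriv_apply, hderiv, norm_div, norm_mul, hlogC, mul_comm (K₀ / (1 - K₀)), ← mul_div_assoc,
      mul_comm (Real.log p)]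
    exact div_le_div₀ (by positivity) (mul_le_mul_of_nonneg_right hn hlogp) (by linarith) hden
  -- the sum
  have hq0 : 0 < q := Nat.pos_of_ne_zero (NeZero.ne q)
  calc ‖∑ p ∈ q.primeFactors, logDeriv (fun s : ℂ ↦ 1 - (p : ℂ) ^ (-s)) s‖
      ≤ ∑ p ∈ q.primeFactors, ‖logDeriv (fun s : ℂ ↦ 1 - (p : ℂ) ^ (-s)) s‖ := norm_sum_le _ _
    _ ≤ ∑ p ∈ q.primeFactors, K₀ / (1 - K₀) * Real.log p := Finset.sum_le_sum hterm
    _ = K₀ / (1 - K₀) * Real.log (∏ p ∈ q.primeFactors, (p : ℝ)) := by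
        rw [← Finset.mul_sum, Real.log_prod]
        intro p hp
        exact_mod_cast (Nat.prime_of_mem_primeFactors hp).ne_zero
    _ ≤ K₀ / (1 - K₀) * Real.log q := by
        refine mul_le_mul_of_nonneg_left (Real.log_le_log ?_ ?_) (div_nonneg hK0.le (by linarith))
        · exact Finset.prod_pos fun p hp ↦ by exact_mod_cast (Nat.prime_of_mem_primeFactors hp).pos
        · rw [← Nat.cast_prod]
          exact_mod_cast Nat.le_of_dvd hq0 (Nat.prod_primeFactors_dvd q)

/-! ### The principal character: `L₁(s, χ₀) = P_q(s) ζ₁(s)` -/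

/-- **MV (4.22) for the completed functions**: Mathlib's entire `L₁(s, χ₀) = (s − 1)L(s, χ₀)`
(`DirichletCharacter.LFunctionTrivChar₁ q`) equals `P_q(s) ζ₁(s)` for every `s`
(`ζ₁ = (s−1)ζ`, Mathlib's `riemannZeta₁`; at `s = 1` both sides are `∏_{p ∣ q}(1 − 1/p)`).
[cite: MontgomeryVaughan2007, §11.1 Lemma 11.1 (proof, eq. (4.22))] -/
theorem LFunctionTrivChar₁_eq (q : ℕ) [NeZero q] (s : ℂ) :
    LFunctionTrivChar₁ q s = eulerFactor q s * riemannZeta₁ s := by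
  rcases eq_or_ne s 1 with rfl | hs
  · rw [DirichletCharacter.LFunctionTrivChar₁, Function.update_self, riemannZeta₁_one, mul_one,
      eulerFactor]
    refine Finset.prod_congr rfl fun p _ ↦ ?_
    rw [Complex.cpow_neg_one]
  · rw [DirichletCharacter.LFunctionTrivChar₁, Function.update_of_ne hs,
      DirichletCharacter.LFunctionTrivChar_eq_mul_riemannZeta hs,
      Literature.NumberTheory.LFunctions.riemannZeta₁_eq_mul hs, eulerFactor]
    ring

/-- **The disc package for `χ₀` mod `q`.** There is an absolute `C` such that for every `q`, every
real `t` and every `s` with `|s − (2 + it)| ≤ 7/4` and `ζ₁(s) ≠ 0`: `L₁(s, χ₀) ≠ 0` and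
`‖L₁'/L₁(s, χ₀) − ∑_{ρ ∈ zetaDiscZeros t} m(ρ)/(s − ρ)‖ ≤ C (log q + log(|t| + 4))`
(`L₁'/L₁ = ζ₁'/ζ₁ + P'/P`, the tree's Lemma 12.1 for `ζ₁`, and `|P'/P| ≪ log q`).
[cite: MontgomeryVaughan2007, Lemma 12.6] -/
theorem exists_trivChar_package :
    ∃ C : ℝ, 0 < C ∧ ∀ (q : ℕ) [NeZero q] (t : ℝ), ∀ s ∈ closedBall (2 + (t : ℂ) * I) (7 / 4),
      riemannZeta₁ s ≠ 0 →
        LFunctionTrivChar₁ q s ≠ 0 ∧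
        ‖logDeriv (LFunctionTrivChar₁ q) s -
            ∑ ρ ∈ zetaDiscZeros t, (zetaDiscDivisor t ρ : ℂ) / (s - ρ)‖ ≤
          C * (Real.log q + Real.log (|t| + 4)) := by
  obtain ⟨Cζ, hCζ0, hCζ⟩ := Literature.NumberTheory.LFunctions.exists_norm_logDeriv_riemannZeta₁_sub_sum_le
  have hK0 := K₀_pos
  have hK1 := K₀_lt_one
  set E₀ : ℝ := K₀ / (1 - K₀) with hE₀
  have hE₀0 : 0 ≤ E₀ := div_nonneg hK0.le (by linarith)
  refine ⟨max Cζ E₀, lt_max_of_lt_left hCζ0, fun q _ t s hs hζ ↦ ?_⟩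
  have hre : 1 / 4 ≤ s.re := by have := DirichletDisc.disc_re_ge hs; linarith
  obtain ⟨hP, hPb⟩ := eulerFactor_ne_zero_and_norm_logDeriv_le q hre
  have hfun : LFunctionTrivChar₁ q = fun s ↦ eulerFactor q s * riemannZeta₁ s :=
    funext (LFunctionTrivChar₁_eq q)
  refine ⟨by rw [LFunctionTrivChar₁_eq]; exact mul_ne_zero hP hζ, ?_⟩
  have hmul : logDeriv (LFunctionTrivChar₁ q) s = logDeriv (eulerFactor q) s + logDeriv riemannZeta₁ s := by
    rw [hfun]
    exact logDeriv_mul s hP hζ ((differentiable_eulerFactor q) s) (differentiable_riemannZeta₁ s)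
  have hlogq : 0 ≤ Real.log q := Real.log_natCast_nonneg q
  have hlog4 : 0 ≤ Real.log (|t| + 4) := Real.log_nonneg (by linarith [abs_nonneg t])
  have h1 := hCζ t s hs hζ
  rw [hmul, add_sub_assoc]
  calc ‖logDeriv (eulerFactor q) s + (logDeriv riemannZeta₁ s -
        ∑ ρ ∈ zetaDiscZeros t, (zetaDiscDivisor t ρ : ℂ) / (s - ρ))‖
      ≤ ‖logDeriv (eulerFactor q) s‖ + ‖logDeriv riemannZeta₁ s -
        ∑ ρ ∈ zetaDiscZeros t, (zetaDiscDivisor t ρ : ℂ) / (s - ρ)‖ := norm_add_le _ _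
    _ ≤ E₀ * Real.log q + Cζ * Real.log (|t| + 4) := add_le_add hPb h1
    _ ≤ max Cζ E₀ * Real.log q + max Cζ E₀ * Real.log (|t| + 4) := by
        gcongr
        · exact le_max_right _ _
        · exact le_max_left _ _
    _ = max Cζ E₀ * (Real.log q + Real.log (|t| + 4)) := by ring

/-! ### `F_{q,a} = φ(q) · LFunctionResidueClassAux a` -/

variable {q : ℕ} [NeZero q]

/-- `L₁(s, χ₀) ≠ 0` as soon as `s = 1` or `L(s, χ₀) ≠ 0`. [folklore] -/
theorem LFunctionTrivChar₁_ne_zero {s : ℂ} (hs : s = 1 ∨ LFunction (1 : DirichletCharacter ℂ q) s ≠ 0) :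
    LFunctionTrivChar₁ q s ≠ 0 := by
  rcases eq_or_ne s 1 with rfl | hs1
  · exact DirichletCharacter.LFunctionTrivChar₁_apply_one_ne_zero q
  · have hL : LFunction (1 : DirichletCharacter ℂ q) s ≠ 0 := hs.resolve_left hs1
    rw [DirichletCharacter.LFunctionTrivChar₁, Function.update_of_ne hs1]
    exact mul_ne_zero (sub_ne_zero.2 hs1) hL

/-- **`F_{q,a}` unfolded** (MV (11.22)): for every `s`,
`φ(q) · LFunctionResidueClassAux a s = −L₁'/L₁(s, χ₀) − ∑_{χ ≠ χ₀} χ̄(a) L'/L(s, χ)`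
(logarithmic derivatives in the sense of Mathlib's `logDeriv`).
[cite: MontgomeryVaughan2007, §11.3 eq. (11.22)] -/
theorem Faux_eq {inst : DecidableEq (DirichletCharacter ℂ q)} (a : ZMod q) (s : ℂ) :
    (q.totient : ℂ) * LFunctionResidueClassAux a s =
      -logDeriv (LFunctionTrivChar₁ q) s -
        ∑ χ ∈ ({1}ᶜ : Finset (DirichletCharacter ℂ q)), χ a⁻¹ * logDeriv χ.LFunction s := by
  have hφ : (q.totient : ℂ) ≠ 0 := by exact_mod_cast (Nat.totient_pos.2 (NeZero.pos q)).ne'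
  simp only [LFunctionResidueClassAux, ← mul_assoc, mul_inv_cancel₀ hφ, one_mul, logDeriv_apply,
    neg_div, mul_div_assoc]
  congr 1
  exact Finset.sum_congr (by ext χ; simp) fun _ _ ↦ rfl

/-- **`F_{q,a}` is holomorphic off the zeros** (including at `s = 1`): if `s = 1` or
`L(s, χ) ≠ 0` for every `χ` mod `q`, then `s ↦ φ(q) · LFunctionResidueClassAux a s` is complex
differentiable at `s`. [folklore] -/
theorem differentiableAt_Faux (a : ZMod q) {s : ℂ}
    (hs : s = 1 ∨ ∀ χ : DirichletCharacter ℂ q, χ.LFunction s ≠ 0) :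
    DifferentiableAt ℂ (fun s ↦ (q.totient : ℂ) * LFunctionResidueClassAux a s) s := by
  have hT := DirichletCharacter.differentiable_LFunctionTrivChar₁ q
  have hT' : DifferentiableAt ℂ (deriv (LFunctionTrivChar₁ q)) s :=
    ((hT.analyticAt s).deriv).differentiableAt
  have hL₁ : LFunctionTrivChar₁ q s ≠ 0 :=
    LFunctionTrivChar₁_ne_zero (hs.imp_right fun h ↦ h 1)
  simp only [LFunctionResidueClassAux]
  refine DifferentiableAt.const_mul (DifferentiableAt.const_mul (DifferentiableAt.fun_sub ?_ ?_) _) _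
  · exact hT'.fun_neg.fun_div (hT s) hL₁
  · refine DifferentiableAt.fun_sum fun χ hχ' ↦ ?_
    have hχ1 : χ ≠ 1 := by simpa using hχ'
    have hLχ := DirichletCharacter.differentiable_LFunction hχ1
    have hLχ' : DifferentiableAt ℂ (deriv χ.LFunction) s := ((hLχ.analyticAt s).deriv).differentiableAt
    have hne : χ.LFunction s ≠ 0 := by
      rcases hs with rfl | hs
      · exact DirichletCharacter.LFunction_ne_zero_of_one_le_re χ (.inl hχ1) (by simp)
      · exact hs χ
    exact (hLχ'.const_mul _).fun_div (hLχ s) hne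

/-- The number of characters mod `q` other than `χ₀` is at most `φ(q)`. [folklore] -/
theorem card_compl_one_le_totient (q : ℕ) [NeZero q] {inst : DecidableEq (DirichletCharacter ℂ q)} :
    (Finset.card ({1}ᶜ : Finset (DirichletCharacter ℂ q)) : ℝ) ≤ q.totient := by
  have h1 : Finset.card ({1}ᶜ : Finset (DirichletCharacter ℂ q)) ≤
      Fintype.card (DirichletCharacter ℂ q) := Finset.card_le_univ _
  have h2 : Fintype.card (DirichletCharacter ℂ q) = q.totient := by
    rw [← Nat.card_eq_fintype_card]
    exact DirichletCharacter.card_eq_totient_of_hasEnoughRootsOfUnity ℂ q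
  exact_mod_cast h1.trans h2.le

/-! ### The package -/

/-- **The local partial fraction of `F_{q,a}`, uniformly in `q`** (MV Lemma 12.6 for all `χ` mod
`q`, summed with the weights `χ̄(a)`). There is an absolute constant `C` such that for every `q`,
every residue `a mod q` and every real `t` there are a finite set `Z ⊂ ℂ` and weights
`w : ℂ → ℂ` with:
(i) every `ρ ∈ Z` is a zero of some `L(s, χ)`, `χ` mod `q`, with `3/20 ≤ Re ρ < 1` and
`|Im ρ − t| ≤ 2`; (ii) `∑_{ρ ∈ Z} |w(ρ)| ≤ C φ(q) ℒ`, `ℒ = log q + log(|t| + 4)`;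
(iii) for `|s − (2 + it)| ≤ 38/25`, `s ≠ 1`, `L(s, χ) ≠ 0` for all `χ`:
`‖F_{q,a}(s) − ∑_{ρ ∈ Z} w(ρ)/(s − ρ)‖ ≤ C φ(q) ℒ`; (iv) if moreover every `ρ ∈ Z` has
`‖s − ρ‖ ≥ d > 0` then `‖F_{q,a}(s)‖ ≤ C φ(q) (1 + 1/d) ℒ`. Here
`F_{q,a} = φ(q) · LFunctionResidueClassAux a`, `Z` is the union of the tree's `zetaDiscZeros t`
and `DirichletDisc.discZeros χ t` (`χ ≠ χ₀`), and `w(ρ) = −m_ζ(ρ) − ∑_{χ ≠ χ₀} χ̄(a) m_χ(ρ)`.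
[cite: MontgomeryVaughan2007, Lemma 12.6] -/
theorem exists_package :
    ∃ C : ℝ, 0 < C ∧ ∀ (q : ℕ) [NeZero q] (a : ZMod q) (t : ℝ),
      ∃ (Z : Finset ℂ) (w : ℂ → ℂ),
        (∀ ρ ∈ Z, (∃ χ : DirichletCharacter ℂ q, χ.LFunction ρ = 0) ∧
            3 / 20 ≤ ρ.re ∧ ρ.re < 1 ∧ |ρ.im - t| ≤ 2) ∧
        (∑ ρ ∈ Z, ‖w ρ‖ ≤ C * q.totient * (Real.log q + Real.log (|t| + 4))) ∧
        (∀ s ∈ closedBall (2 + (t : ℂ) * I) (38 / 25), s ≠ 1 →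
          (∀ χ : DirichletCharacter ℂ q, χ.LFunction s ≠ 0) →
          ‖(q.totient : ℂ) * LFunctionResidueClassAux a s - ∑ ρ ∈ Z, w ρ / (s - ρ)‖ ≤
            C * q.totient * (Real.log q + Real.log (|t| + 4))) ∧
        (∀ s ∈ closedBall (2 + (t : ℂ) * I) (38 / 25), s ≠ 1 →
          (∀ χ : DirichletCharacter ℂ q, χ.LFunction s ≠ 0) → ∀ d : ℝ, 0 < d →
          (∀ ρ ∈ Z, d ≤ ‖s - ρ‖) →
          ‖(q.totient : ℂ) * LFunctionResidueClassAux a s‖ ≤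
            C * q.totient * (1 + 1 / d) * (Real.log q + Real.log (|t| + 4))) := by
  classical
  obtain ⟨C₁, hC₁0, hC₁⟩ := exists_trivChar_package
  obtain ⟨C₂, hC₂0, hC₂⟩ := Literature.NumberTheory.LFunctions.exists_sum_zetaDiscZeros_le
  obtain ⟨C₃, hC₃0, hC₃⟩ := DirichletDisc.exists_norm_logDeriv_sub_sum_le
  obtain ⟨C₄, hC₄0, hC₄⟩ := DirichletDisc.exists_sum_discZeros_le
  set C : ℝ := C₁ + C₂ + C₃ + C₄ with hCdef
  have hC0 : 0 < C := by positivity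
  refine ⟨C, hC0, fun q _ a t ↦ ?_⟩
  -- notation
  set ℒ : ℝ := Real.log q + Real.log (|t| + 4) with hℒdef
  have hℒ1 : 1 ≤ ℒ := DirichletZFR.one_le_ell q t
  have hℒ0 : 0 ≤ ℒ := by linarith
  have hlog4 : 0 ≤ Real.log (|t| + 4) := Real.log_nonneg (by linarith [abs_nonneg t])
  have hlog4ℒ : Real.log (|t| + 4) ≤ ℒ := by
    have : 0 ≤ Real.log q := Real.log_natCast_nonneg q
    linarith
  have hφ1 : (1 : ℝ) ≤ q.totient := by exact_mod_cast Nat.totient_pos.2 (NeZero.pos q)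
  have hφ0 : (0 : ℝ) ≤ q.totient := by linarith
  set X : Finset (DirichletCharacter ℂ q) := ({1}ᶜ : Finset (DirichletCharacter ℂ q)) with hXdef
  have hXcard : (X.card : ℝ) ≤ q.totient := card_compl_one_le_totient q
  have hX : ∀ χ ∈ X, χ ≠ 1 := fun χ hχ ↦ by simpa [hXdef] using hχ
  -- the zero set and the weights
  set Z : Finset ℂ := zetaDiscZeros t ∪ X.biUnion (fun χ ↦ DirichletDisc.discZeros χ t) with hZdef
  set w : ℂ → ℂ := fun ρ ↦ -((zetaDiscDivisor t ρ : ℂ) +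
    ∑ χ ∈ X, χ a⁻¹ * (DirichletDisc.discDivisor χ t ρ : ℂ)) with hwdef
  have hZζ : zetaDiscZeros t ⊆ Z := by rw [hZdef]; exact Finset.subset_union_left
  have hZχ : ∀ χ ∈ X, DirichletDisc.discZeros χ t ⊆ Z := fun χ hχ ↦ by
    rw [hZdef]
    exact (Finset.subset_biUnion_of_mem (fun χ ↦ DirichletDisc.discZeros χ t) hχ).trans
      Finset.subset_union_right
  -- vanishing of the divisors off their supports
  have hζ0 : ∀ ρ, ρ ∉ zetaDiscZeros t → zetaDiscDivisor t ρ = 0 := by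
    intro ρ hρ
    by_contra h
    exact hρ (by rw [zetaDiscZeros, Set.Finite.mem_toFinset]; exact Function.mem_support.2 h)
  have hχ0 : ∀ χ : DirichletCharacter ℂ q, ∀ ρ, ρ ∉ DirichletDisc.discZeros χ t →
      DirichletDisc.discDivisor χ t ρ = 0 := by
    intro χ ρ hρ
    by_contra h
    exact hρ (by rw [DirichletDisc.discZeros, Set.Finite.mem_toFinset]; exact Function.mem_support.2 h)
  have hi : ∀ ρ ∈ Z, (∃ χ : DirichletCharacter ℂ q, χ.LFunction ρ = 0) ∧
      3 / 20 ≤ ρ.re ∧ ρ.re < 1 ∧ |ρ.im - t| ≤ 2 := by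
    intro ρ hρ
    rw [hZdef, Finset.mem_union, Finset.mem_biUnion] at hρ
    rcases hρ with hρ | ⟨χ, hχX, hρ⟩
    · obtain ⟨hz, hne1, him, hre, -, -⟩ := zetaDiscZeros_prop hρ
      refine ⟨⟨1, ?_⟩, hre, re_lt_one_of_riemannZeta_eq_zero hz, him.trans (by norm_num)⟩
      change LFunctionTrivChar q ρ = 0
      rw [DirichletCharacter.LFunctionTrivChar_eq_mul_riemannZeta hne1, hz, mul_zero]
    · obtain ⟨hz, him, hre, hre1, -, -⟩ := DirichletDisc.discZeros_prop (hX χ hχX) hρ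
      exact ⟨⟨χ, hz⟩, by linarith, hre1, him.trans (by norm_num)⟩
  have hii : ∑ ρ ∈ Z, ‖w ρ‖ ≤ C * q.totient * ℒ := by
    have hterm : ∀ ρ ∈ Z, ‖w ρ‖ ≤ (zetaDiscDivisor t ρ : ℝ) +
        ∑ χ ∈ X, (DirichletDisc.discDivisor χ t ρ : ℝ) := by
      intro ρ _
      rw [hwdef]
      simp only [norm_neg]
      refine (norm_add_le _ _).trans (add_le_add ?_ ((norm_sum_le _ _).trans (Finset.sum_le_sum ?_)))
      · rw [Complex.norm_intCast, abs_of_nonneg (by exact_mod_cast zetaDiscDivisor_nonneg t ρ)]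
      · intro χ hχ
        rw [norm_mul, Complex.norm_intCast,
          abs_of_nonneg (by exact_mod_cast DirichletDisc.discDivisor_nonneg (hX χ hχ) t ρ)]
        calc ‖χ a⁻¹‖ * (DirichletDisc.discDivisor χ t ρ : ℝ)
            ≤ 1 * (DirichletDisc.discDivisor χ t ρ : ℝ) :=
              mul_le_mul_of_nonneg_right (DirichletCharacter.norm_le_one χ _)
                (by exact_mod_cast DirichletDisc.discDivisor_nonneg (hX χ hχ) t ρ)
          _ = _ := one_mul _
    have hsumζ : ∑ ρ ∈ Z, (zetaDiscDivisor t ρ : ℝ) = ∑ ρ ∈ zetaDiscZeros t, (zetaDiscDivisor t ρ : ℝ) := by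
      refine (Finset.sum_subset hZζ fun ρ _ hρ ↦ ?_).symm
      rw [hζ0 ρ hρ]; simp
    have hsumχ : ∀ χ ∈ X, ∑ ρ ∈ Z, (DirichletDisc.discDivisor χ t ρ : ℝ) =
        ∑ ρ ∈ DirichletDisc.discZeros χ t, (DirichletDisc.discDivisor χ t ρ : ℝ) := by
      intro χ hχ
      refine (Finset.sum_subset (hZχ χ hχ) fun ρ _ hρ ↦ ?_).symm
      rw [hχ0 χ ρ hρ]; simp
    calc ∑ ρ ∈ Z, ‖w ρ‖
        ≤ ∑ ρ ∈ Z, ((zetaDiscDivisor t ρ : ℝ) + ∑ χ ∈ X, (DirichletDisc.discDivisor χ t ρ : ℝ)) :=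
          Finset.sum_le_sum hterm
      _ = ∑ ρ ∈ zetaDiscZeros t, (zetaDiscDivisor t ρ : ℝ) +
          ∑ χ ∈ X, ∑ ρ ∈ DirichletDisc.discZeros χ t, (DirichletDisc.discDivisor χ t ρ : ℝ) := by
          rw [Finset.sum_add_distrib, Finset.sum_comm, hsumζ, Finset.sum_congr rfl hsumχ]
      _ ≤ C₂ * Real.log (|t| + 4) + ∑ χ ∈ X, C₄ * ℒ := by
          gcongr with χ hχ
          · exact hC₂ t
          · exact hC₄ q χ (hX χ hχ) t
      _ ≤ C₂ * ℒ + q.totient * (C₄ * ℒ) := by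
          rw [Finset.sum_const, nsmul_eq_mul]
          gcongr
      _ ≤ C * q.totient * ℒ := by
          rw [hCdef]
          have h1 : C₂ * ℒ * 1 ≤ C₂ * ℒ * q.totient :=
            mul_le_mul_of_nonneg_left hφ1 (mul_nonneg hC₂0.le hℒ0)
          have h2 : 0 ≤ C₁ * q.totient * ℒ := by positivity
          have h3 : 0 ≤ C₃ * q.totient * ℒ := by positivity
          nlinarith
  have hiii : ∀ s ∈ closedBall (2 + (t : ℂ) * I) (38 / 25), s ≠ 1 →
      (∀ χ : DirichletCharacter ℂ q, χ.LFunction s ≠ 0) →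
      ‖(q.totient : ℂ) * LFunctionResidueClassAux a s - ∑ ρ ∈ Z, w ρ / (s - ρ)‖ ≤
        C * q.totient * ℒ := by
    intro s hs hs1 hL
    have hs74 : s ∈ closedBall (2 + (t : ℂ) * I) (7 / 4) := closedBall_subset_closedBall (by norm_num) hs
    have hζs : riemannZeta s ≠ 0 := by
      intro h
      apply hL 1
      change LFunctionTrivChar q s = 0
      rw [DirichletCharacter.LFunctionTrivChar_eq_mul_riemannZeta hs1, h, mul_zero]
    have hζ₁ : riemannZeta₁ s ≠ 0 := by
      rw [Literature.NumberTheory.LFunctions.riemannZeta₁_eq_mul hs1]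
      exact mul_ne_zero (sub_ne_zero.2 hs1) hζs
    obtain ⟨-, h1⟩ := hC₁ q t s hs74 hζ₁
    have h3 : ∀ χ ∈ X, ‖logDeriv χ.LFunction s -
        ∑ ρ ∈ DirichletDisc.discZeros χ t, (DirichletDisc.discDivisor χ t ρ : ℂ) / (s - ρ)‖ ≤ C₃ * ℒ :=
      fun χ hχ ↦ hC₃ q χ (hX χ hχ) t s hs (hL χ)
    -- rewrite the sums over `Z`
    have hsumζ : ∑ ρ ∈ Z, (zetaDiscDivisor t ρ : ℂ) / (s - ρ) =
        ∑ ρ ∈ zetaDiscZeros t, (zetaDiscDivisor t ρ : ℂ) / (s - ρ) := by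
      refine (Finset.sum_subset hZζ fun ρ _ hρ ↦ ?_).symm
      rw [hζ0 ρ hρ]; simp
    have hsumχ : ∀ χ ∈ X, ∑ ρ ∈ Z, (DirichletDisc.discDivisor χ t ρ : ℂ) / (s - ρ) =
        ∑ ρ ∈ DirichletDisc.discZeros χ t, (DirichletDisc.discDivisor χ t ρ : ℂ) / (s - ρ) := by
      intro χ hχ
      refine (Finset.sum_subset (hZχ χ hχ) fun ρ _ hρ ↦ ?_).symm
      rw [hχ0 χ ρ hρ]; simp
    have hexp : ∑ ρ ∈ Z, w ρ / (s - ρ) =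
        -(∑ ρ ∈ zetaDiscZeros t, (zetaDiscDivisor t ρ : ℂ) / (s - ρ)) -
          ∑ χ ∈ X, χ a⁻¹ *
            ∑ ρ ∈ DirichletDisc.discZeros χ t, (DirichletDisc.discDivisor χ t ρ : ℂ) / (s - ρ) := by
      have hw : ∀ ρ ∈ Z, w ρ / (s - ρ) = -((zetaDiscDivisor t ρ : ℂ) / (s - ρ)) -
          ∑ χ ∈ X, χ a⁻¹ * ((DirichletDisc.discDivisor χ t ρ : ℂ) / (s - ρ)) := by
        intro ρ _
        rw [hwdef]
        simp only [neg_add', sub_div, neg_div, Finset.sum_div, mul_div_assoc]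
      rw [Finset.sum_congr rfl hw, Finset.sum_sub_distrib, Finset.sum_neg_distrib, Finset.sum_comm,
        hsumζ]
      congr 1
      refine Finset.sum_congr rfl fun χ hχ ↦ ?_
      rw [← Finset.mul_sum, hsumχ χ hχ]
    rw [Faux_eq (inst := inferInstance) a s, ← hXdef, hexp]
    have hrew : -logDeriv (LFunctionTrivChar₁ q) s - ∑ χ ∈ X, χ a⁻¹ * logDeriv χ.LFunction s -
        (-(∑ ρ ∈ zetaDiscZeros t, (zetaDiscDivisor t ρ : ℂ) / (s - ρ)) -
          ∑ χ ∈ X, χ a⁻¹ *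
            ∑ ρ ∈ DirichletDisc.discZeros χ t, (DirichletDisc.discDivisor χ t ρ : ℂ) / (s - ρ)) =
        -(logDeriv (LFunctionTrivChar₁ q) s -
            ∑ ρ ∈ zetaDiscZeros t, (zetaDiscDivisor t ρ : ℂ) / (s - ρ)) -
          ∑ χ ∈ X, χ a⁻¹ * (logDeriv χ.LFunction s -
            ∑ ρ ∈ DirichletDisc.discZeros χ t, (DirichletDisc.discDivisor χ t ρ : ℂ) / (s - ρ)) := by
      simp only [mul_sub, Finset.sum_sub_distrib]
      ring
    rw [hrew]
    calc ‖-(logDeriv (LFunctionTrivChar₁ q) s -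
            ∑ ρ ∈ zetaDiscZeros t, (zetaDiscDivisor t ρ : ℂ) / (s - ρ)) -
          ∑ χ ∈ X, χ a⁻¹ * (logDeriv χ.LFunction s -
            ∑ ρ ∈ DirichletDisc.discZeros χ t, (DirichletDisc.discDivisor χ t ρ : ℂ) / (s - ρ))‖
        ≤ ‖logDeriv (LFunctionTrivChar₁ q) s -
            ∑ ρ ∈ zetaDiscZeros t, (zetaDiscDivisor t ρ : ℂ) / (s - ρ)‖ +
          ∑ χ ∈ X, ‖χ a⁻¹ * (logDeriv χ.LFunction s -
            ∑ ρ ∈ DirichletDisc.discZeros χ t, (DirichletDisc.discDivisor χ t ρ : ℂ) / (s - ρ))‖ := by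
          refine (norm_sub_le _ _).trans (add_le_add (by rw [norm_neg]) (norm_sum_le _ _))
      _ ≤ C₁ * ℒ + ∑ χ ∈ X, C₃ * ℒ := by
          refine add_le_add h1 (Finset.sum_le_sum fun χ hχ ↦ ?_)
          rw [norm_mul]
          calc ‖χ a⁻¹‖ * ‖logDeriv χ.LFunction s -
                ∑ ρ ∈ DirichletDisc.discZeros χ t, (DirichletDisc.discDivisor χ t ρ : ℂ) / (s - ρ)‖
              ≤ 1 * (C₃ * ℒ) :=
                mul_le_mul (DirichletCharacter.norm_le_one χ _) (h3 χ hχ) (norm_nonneg _) zero_le_one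
            _ = C₃ * ℒ := one_mul _
      _ ≤ C₁ * ℒ + q.totient * (C₃ * ℒ) := by
          rw [Finset.sum_const, nsmul_eq_mul]
          gcongr
      _ ≤ C * q.totient * ℒ := by
          rw [hCdef]
          have h1 : C₁ * ℒ * 1 ≤ C₁ * ℒ * q.totient :=
            mul_le_mul_of_nonneg_left hφ1 (mul_nonneg hC₁0.le hℒ0)
          have h2 : 0 ≤ C₂ * q.totient * ℒ := by positivity
          have h4 : 0 ≤ C₄ * q.totient * ℒ := by positivity
          nlinarith
  refine ⟨Z, w, hi, hii, hiii, fun s hs hs1 hL d hd hdist ↦ ?_⟩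
  -- (iv) the crude bound off the zeros: combine (ii) and (iii)
  have h3 := hiii s hs hs1 hL
  have hsum : ‖∑ ρ ∈ Z, w ρ / (s - ρ)‖ ≤ (C * q.totient * ℒ) / d := by
    have hterm : ∀ ρ ∈ Z, ‖w ρ / (s - ρ)‖ ≤ ‖w ρ‖ / d := by
      intro ρ hρ
      rw [norm_div]
      exact div_le_div_of_nonneg_left (norm_nonneg _) hd (hdist ρ hρ)
    calc ‖∑ ρ ∈ Z, w ρ / (s - ρ)‖ ≤ ∑ ρ ∈ Z, ‖w ρ / (s - ρ)‖ := norm_sum_le _ _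
      _ ≤ ∑ ρ ∈ Z, ‖w ρ‖ / d := Finset.sum_le_sum hterm
      _ = (∑ ρ ∈ Z, ‖w ρ‖) / d := by rw [Finset.sum_div]
      _ ≤ (C * q.totient * ℒ) / d := div_le_div_of_nonneg_right hii hd.le
  calc ‖(q.totient : ℂ) * LFunctionResidueClassAux a s‖
      = ‖((q.totient : ℂ) * LFunctionResidueClassAux a s - ∑ ρ ∈ Z, w ρ / (s - ρ)) +
          ∑ ρ ∈ Z, w ρ / (s - ρ)‖ := by rw [sub_add_cancel]
    _ ≤ ‖(q.totient : ℂ) * LFunctionResidueClassAux a s - ∑ ρ ∈ Z, w ρ / (s - ρ)‖ +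
          ‖∑ ρ ∈ Z, w ρ / (s - ρ)‖ := norm_add_le _ _
    _ ≤ C * q.totient * ℒ + (C * q.totient * ℒ) / d := add_le_add h3 hsum
    _ = C * q.totient * (1 + 1 / d) * ℒ := by ring

end Literature.NumberTheory.LFunctions.DirichletSegments

end
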